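import Literature.Probability.Percolation.Z2SquareCycles
import Literature.Probability.LatticeModels.StarBoundary
import Literature.Combinatorics.SimpleGraph.CycleSpaceSeparatorsRelative
import HarnessLib

/-!
# FRONTIER TRANSPLANT — K1 in finite form (K1-FIN), piece (P2a-i): the unit squares INSIDE a box generate the even edge
# sets inside the box; chains inside a vertex set; a box of `ℤ²` is nearest-neighbour connected

Support file (`--supports stmt-CriticalPhenomena-4575`, helper) of the FRONTIER TRANSPLANT sub-cell
(`fk-continuity/transplant/`, seat `prim-bschramm-fkt-p3`); builds on p205010 (kernel theorem, internal audit signed;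
external expert review pending). Memo row K1-FIN [g130, R67] (bytes-first package). 0 named facts · 0 sorries ·
standard axioms; pure combinatorics of `ℤ²` (no measure, no `FH`, no `UFSC0` in this file).
Registered R70 (cell INBOX l.5267, 2026-08-23); registry row T4k; lead label T4k-01 (fkt-lead L44, l.5255).

HONEST FRAMING (page 1, cell rule). The transplant's theorem of record `ufsc0_of_freeBoundaryHypothesis_r3` is
CONDITIONAL on FH AND on TP_FK, both OPEN at the same `p` for `q > 1` (⇔ GRC Conj. (5.103) via K1; barrier note
`Literature.Barriers.CriticalPhenomena.SamePFreeBoundaryCriteria`, FBN-01); the transplant is a typed reduction, not a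
proof of FK continuity. K1-FIN is the arrow `(∃ r, UFSC0) ⟹ (∃ L, Π(p, L))` (Grimmett's FINITE free slabs) making the
referee's calibration K1 a kernel EQUIVALENCE; it changes nothing in the record (`_r3` « 2 / 0 ☑ », n_open = 2).

## What is here (namespace `Summit.CriticalPhenomena.PercolationContinuityZ3.Theorems.FK.SlabBox`)

Input of Timár's boundary-connectivity lemma for the square lattice INDUCED ON A BOX (file (P2a-ii)
`UFSC0SlabBoxBoundary`): the generating family of its cycle space.

* §1 `boxSquares`, `inSpan_boxSquares` — the unit squares with all four corners in `Λ = [a, b]` generate (over `𝔽₂`)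
  every even set of lattice edges inside `Λ` (the tree's peeling `Z2SquareCycles.peel_step` only ever adds such squares);
  `zdStar_adj_of_mem_squareEdges` (the corners of a unit square are pairwise `★`-adjacent);
* §2 `adjIn G S` (adjacency with both endpoints in `S`), chains ↔ walks inside a set, `reflTransGen_adjIn_restrict`;
  `reflTransGen_adjIn_update*`, `reflTransGen_adjIn_Icc` (a coordinate box of `ℤ²` is nn-connected).

## References

* Á. Timár, *Boundary-connectivity via graph theory*, Proc. AMS 141 (2013) 475–480, §2, Lemma 1 [Timar2013].
* S. Friedli, Y. Velenik, *Statistical Mechanics of Lattice Systems*, CUP 2017, App. B.15, Lemma B.81 [FriedliVelenik2017].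
* G. Grimmett, *The Random-Cluster Model*, Springer 2006, §5.7 Conj. (5.103) [Grimmett2006].
-/

noncomputable section

open Finset SimpleGraph Relation
open Literature.Combinatorics.SimpleGraph.CycleSpace

namespace Summit.CriticalPhenomena.PercolationContinuityZ3.Theorems.FK

namespace SlabBox

open Literature.Probability.Percolation Literature.Probability.LatticeModels

/-! ### §1 The unit squares inside a box generate the even edge sets inside the box -/

/-- The boundaries of the unit squares of `ℤ²` all of whose corners lie in the box `[a, b]` (the generating family
of the cycle space of the square lattice induced on the box). [cite: Timar2013, §2 (the 4-cycles generate)] -/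
def boxSquares (a b : Site 2) : Set (Finset (Sym2 (Site 2))) :=
  {C | (∃ g, C = squareEdges g) ∧ ∀ e ∈ C, ∀ x ∈ e, x ∈ Finset.Icc a b}

/-- A square whose symmetric difference with an edge set inside the box stays inside the box is a box square.
[folklore] -/
theorem squareEdges_mem_boxSquares_of_symmDiff {a b : Site 2} {Z : Finset (Sym2 (Site 2))} (g : Site 2)
    (hZ : BoxEven a b Z) (hZ' : BoxEven a b (symmDiff (squareEdges g) Z)) :
    squareEdges g ∈ boxSquares a b := by
  refine ⟨⟨g, rfl⟩, fun e he x hx => ?_⟩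
  by_cases heZ : e ∈ Z
  · exact hZ.2.2 e heZ x hx
  · exact hZ'.2.2 e (Finset.mem_symmDiff.2 (Or.inl ⟨he, heZ⟩)) x hx

/-- **Row induction inside the box** (the tree's `inSpan_squares_row`, keeping the squares in the box): if every
even set of lattice edges in the box strictly below the row `y = H` is a sum of box squares, so is every even set
weakly below it. [cite: Timar2013, §2 (proof of Theorem 3)] -/
theorem inSpan_boxSquares_row {a b : Site 2} {H : ℤ}
    (hlow : ∀ Z : Finset (Sym2 (Site 2)), BoxEven a b Z → (∀ e ∈ Z, ∀ x ∈ e, x 1 ≤ H - 1) →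
      InSpan (boxSquares a b) Z) :
    ∀ (c : ℕ) (Z : Finset (Sym2 (Site 2))), BoxEven a b Z → (∀ e ∈ Z, ∀ x ∈ e, x 1 ≤ H) →
      #(topEnds a b Z H) ≤ c → InSpan (boxSquares a b) Z := by
  classical
  have hempty : ∀ Z : Finset (Sym2 (Site 2)), BoxEven a b Z → (∀ e ∈ Z, ∀ x ∈ e, x 1 ≤ H) →
      topEnds a b Z H = ∅ → InSpan (boxSquares a b) Z := by
    intro Z hZ hH hT
    refine hlow Z hZ fun e he x hx => ?_
    have hx1 := hH e he x hx
    by_contra hlt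
    have hx' : x ∈ topEnds a b Z H := mem_topEnds_iff.2 ⟨hZ.2.2 e he x hx, by omega, e, he, hx⟩
    rw [hT] at hx'
    exact absurd hx' (Finset.notMem_empty _)
  intro c
  induction c with
  | zero =>
    intro Z hZ hH hc
    rw [Nat.le_zero, Finset.card_eq_zero] at hc
    exact hempty Z hZ hH hc
  | succ c ihc =>
    intro Z hZ hH hc
    by_cases hT : topEnds a b Z H = ∅
    · exact hempty Z hZ hH hT
    · obtain ⟨v, hv, hmax⟩ :=
        Finset.exists_max_image _ (fun w : Site 2 => w 0) (Finset.nonempty_iff_ne_empty.2 hT)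
      obtain ⟨hZ', hH', hT'⟩ := peel_step hZ hH hv hmax
      have hcard : #(topEnds a b (symmDiff (squareEdges (v - Pi.single 0 1 - Pi.single 1 1)) Z) H) ≤ c := by
        have := Finset.card_le_card hT'
        rw [Finset.card_erase_of_mem hv] at this
        omega
      have hstep := InSpan.step (𝒞 := boxSquares a b) (C := squareEdges (v - Pi.single 0 1 - Pi.single 1 1))
        (squareEdges_mem_boxSquares_of_symmDiff _ hZ hZ') (ihc _ hZ' hH' hcard)
      rwa [symmDiff_symmDiff_cancel_left] at hstep

/-- **Peeling induction inside the box**: an even set of lattice edges inside the box `[a, b]` whose top row is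
at height `≤ a₁ + h` is a sum of box squares. [cite: Timar2013, §2 (proof of Theorem 3)] -/
theorem inSpan_boxSquares_of_boxEven (a b : Site 2) :
    ∀ (h : ℕ) (Z : Finset (Sym2 (Site 2))), BoxEven a b Z → (∀ e ∈ Z, ∀ x ∈ e, x 1 ≤ a 1 + h) →
      InSpan (boxSquares a b) Z := by
  classical
  intro h
  induction h with
  | zero =>
    intro Z hZ hH
    refine inSpan_boxSquares_row (H := a 1) (fun Z' hZ' hH' => ?_) _ Z hZ (fun e he x hx => by
      have := hH e he x hx; push_cast at this; omega) le_rfl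
    have hZe : Z' = ∅ := by
      rw [Finset.eq_empty_iff_forall_notMem]
      intro e he
      induction e using Sym2.ind with
      | h x y =>
        have hxI := mem_Icc_site_iff.1 (hZ'.2.2 _ he x (Sym2.mem_mk_left _ _))
        have hx1 := hH' _ he x (Sym2.mem_mk_left _ _)
        omega
    rw [hZe]; exact InSpan.empty
  | succ h ihh =>
    intro Z hZ hH
    refine inSpan_boxSquares_row (H := a 1 + ↑(h + 1)) (fun Z' hZ' hH' => ihh Z' hZ' fun e he x hx => ?_) _ Z hZ
      hH le_rfl
    have := hH' e he x hx
    push_cast at this ⊢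
    omega

/-- **The box squares generate the cycle space of the square lattice induced on the box**: every even set of
lattice edges with all endpoints in `[a, b]` is a sum modulo 2 of boundaries of unit squares inside `[a, b]`.
[cite: Timar2013, §2 (the 4-cycles generate the cycle space); FriedliVelenik2017, App. B.15, Lemma B.81] -/
theorem inSpan_boxSquares {a b : Site 2} {Z : Finset (Sym2 (Site 2))}
    (hZ : ∀ e ∈ Z, e ∈ (zdGraph 2).edgeSet ∧ ∀ x ∈ e, x ∈ (↑(Finset.Icc a b) : Set (Site 2)))
    (heven : IsEvenEdgeSet Z) : InSpan (boxSquares a b) Z := by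
  have hbox : BoxEven a b Z :=
    ⟨fun e he => (hZ e he).1, heven, fun e he x hx => Finset.mem_coe.1 ((hZ e he).2 x hx)⟩
  refine inSpan_boxSquares_of_boxEven a b (b 1 - a 1).toNat Z hbox fun e he x hx => ?_
  have h1 := (mem_Icc_site_iff.1 (hbox.2.2 e he x hx)).2.2
  have h2 := Int.self_le_toNat (b 1 - a 1)
  omega

/-- Box squares are even edge sets. [folklore] -/
theorem isEvenEdgeSet_of_mem_boxSquares {a b : Site 2} {C : Finset (Sym2 (Site 2))} (hC : C ∈ boxSquares a b) :
    IsEvenEdgeSet C := by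
  obtain ⟨⟨g, rfl⟩, -⟩ := hC
  exact isEvenEdgeSet_squareEdges g

/-- Box squares consist of lattice edges inside the box. [folklore] -/
theorem mem_edgeSet_of_mem_boxSquares {a b : Site 2} {C : Finset (Sym2 (Site 2))} (hC : C ∈ boxSquares a b) :
    ∀ e ∈ C, e ∈ (zdGraph 2).edgeSet ∧ ∀ x ∈ e, x ∈ (↑(Finset.Icc a b) : Set (Site 2)) := by
  obtain ⟨⟨g, rfl⟩, hbox⟩ := hC
  exact fun e he => ⟨squareEdges_subset_edgeSet g e he, fun x hx => Finset.mem_coe.2 (hbox e he x hx)⟩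

/-- **The corners of a unit square are pairwise `★`-adjacent**: two distinct endpoints of edges of the same square
differ by at most `1` in each coordinate. [folklore] -/
theorem zdStar_adj_of_mem_squareEdges {g : Site 2} {e₁ e₂ : Sym2 (Site 2)} (he₁ : e₁ ∈ squareEdges g)
    (he₂ : e₂ ∈ squareEdges g) {v₁ v₂ : Site 2} (hv₁ : v₁ ∈ e₁) (hv₂ : v₂ ∈ e₂) (hne : v₁ ≠ v₂) :
    (zdStar 2).Adj v₁ v₂ := by
  have hc : ∀ e ∈ squareEdges g, ∀ v ∈ e, ∀ j : Fin 2, g j ≤ v j ∧ v j ≤ g j + 1 := by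
    intro e he v hv j
    simp only [squareEdges, Finset.mem_insert, Finset.mem_singleton] at he
    rcases he with rfl | rfl | rfl | rfl <;> rcases Sym2.mem_iff.1 hv with rfl | rfl <;> fin_cases j <;> simp
  refine zdStar_adj_of_forall hne fun j => ?_
  have h1 := hc _ he₁ _ hv₁ j
  have h2 := hc _ he₂ _ hv₂ j
  omega

/-! ### §2 Chains inside a set of vertices -/

section AdjIn

variable {V : Type*} (G : SimpleGraph V)

/-- The adjacency of `G` restricted to the set `S` (both endpoints in `S`), as a relation; its reflexive-transitive
closure is "joined by a `G`-path inside `S`" (the tree's `starRel` is the case `G = ℤ^{d★}`).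
[cite: FriedliVelenik2017, App. B.15 (connected sets of vertices); Timar2013, §1] -/
def adjIn (S : Set V) (a b : V) : Prop := G.Adj a b ∧ a ∈ S ∧ b ∈ S

variable {G}

/-- The restricted adjacency is symmetric. [folklore] -/
theorem adjIn_symm {S : Set V} {a b : V} (h : adjIn G S a b) : adjIn G S b a := ⟨h.1.symm, h.2.2, h.2.1⟩

/-- Monotonicity of the restricted adjacency in the set. [folklore] -/
theorem adjIn_mono {S T : Set V} (hST : S ⊆ T) {a b : V} (h : adjIn G S a b) : adjIn G T a b :=
  ⟨h.1, hST h.2.1, hST h.2.2⟩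

/-- A chain inside `S` from a point of `S` ends in `S`. [folklore] -/
theorem mem_of_reflTransGen_adjIn {S : Set V} {x y : V} (h : ReflTransGen (adjIn G S) x y) (hx : x ∈ S) :
    y ∈ S := by
  induction h with
  | refl => exact hx
  | tail _ hbc _ => exact hbc.2.2

/-- Chains inside a larger set. [folklore] -/
theorem reflTransGen_adjIn_mono {S T : Set V} (hST : S ⊆ T) {x y : V} (h : ReflTransGen (adjIn G S) x y) :
    ReflTransGen (adjIn G T) x y := by
  induction h with
  | refl => exact ReflTransGen.refl
  | tail _ hbc ih => exact ih.tail (adjIn_mono hST hbc)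

/-- Chains inside a set can be reversed. [folklore] -/
theorem reflTransGen_adjIn_symm {S : Set V} {x y : V} (h : ReflTransGen (adjIn G S) x y) :
    ReflTransGen (adjIn G S) y x := by
  induction h with
  | refl => exact ReflTransGen.refl
  | tail _ hbc ih => exact ReflTransGen.head (adjIn_symm hbc) ih

/-- From a chain inside `S` to a `G`-walk with support in `S`. [folklore] -/
theorem exists_walk_of_reflTransGen_adjIn {S : Set V} {x y : V} (h : ReflTransGen (adjIn G S) x y) (hx : x ∈ S) :
    ∃ p : G.Walk x y, ∀ w ∈ p.support, w ∈ S := by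
  induction h with
  | refl => exact ⟨Walk.nil, fun w hw => by rw [Walk.support_nil, List.mem_singleton] at hw; rw [hw]; exact hx⟩
  | tail _ hbc ih =>
    obtain ⟨p, hp⟩ := ih
    refine ⟨p.concat hbc.1, fun w hw => ?_⟩
    rw [Walk.support_concat, List.mem_append, List.mem_singleton] at hw
    rcases hw with hw | rfl
    · exact hp w hw
    · exact hbc.2.2

/-- From a `G`-walk with support in `S` to a chain inside `S`. [folklore] -/
theorem reflTransGen_adjIn_of_walk {S : Set V} {x y : V} (p : G.Walk x y) (hp : ∀ w ∈ p.support, w ∈ S) :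
    ReflTransGen (adjIn G S) x y := by
  induction p with
  | nil => exact ReflTransGen.refl
  | cons h p ih =>
    rename_i u v w
    have hu : u ∈ S := hp u (Walk.start_mem_support _)
    have hv : v ∈ S := hp v (by rw [Walk.support_cons]; exact List.mem_cons_of_mem _ (Walk.start_mem_support p))
    exact ReflTransGen.head ⟨h, hu, hv⟩ (ih fun w hw => hp w (by rw [Walk.support_cons]; exact List.mem_cons_of_mem _ hw))

/-- A chain inside `U` starting in a set `C` closed under `U`-steps stays in `C`. [folklore] -/
theorem reflTransGen_adjIn_restrict {U C : Set V} (hC : ∀ a ∈ C, ∀ b, adjIn G U a b → b ∈ C)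
    {x y : V} (hx : x ∈ C) (h : ReflTransGen (adjIn G U) x y) : ReflTransGen (adjIn G C) x y := by
  induction h with
  | refl => exact ReflTransGen.refl
  | tail _ hbc ih =>
    rename_i b c _
    have hb : b ∈ C := mem_of_reflTransGen_adjIn ih hx
    exact ih.tail ⟨hbc.1, hb, hC b hb c hbc⟩

end AdjIn

/-! ### The box is nearest-neighbour connected -/

/-- Moving `n` unit steps up in coordinate `k` along a segment contained in `T`. [folklore] -/
theorem reflTransGen_adjIn_update_add {T : Set (Site 2)} (x : Site 2) (k : Fin 2) (n : ℕ)
    (h : ∀ m : ℕ, m ≤ n → Function.update x k (x k + m) ∈ T) :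
    ReflTransGen (adjIn (zdGraph 2) T) x (Function.update x k (x k + n)) := by
  induction n with
  | zero => simp only [Nat.cast_zero, add_zero, Function.update_eq_self]; exact ReflTransGen.refl
  | succ n ih =>
    refine (ih fun m hm => h m (by omega)).tail ⟨?_, h n (by omega), by exact_mod_cast h (n + 1) le_rfl⟩
    rw [zdGraph_adj_iff]
    refine ⟨k, Or.inl ?_⟩
    funext j
    by_cases hj : j = k
    · subst hj; simp only [Function.update_self, Pi.add_apply, Pi.single_eq_same]; push_cast; ring
    · simp only [Pi.add_apply, Function.update_of_ne hj, Pi.single_eq_of_ne hj, add_zero]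

/-- Moving `n` unit steps down in coordinate `k` along a segment contained in `T`. [folklore] -/
theorem reflTransGen_adjIn_update_sub {T : Set (Site 2)} (x : Site 2) (k : Fin 2) (n : ℕ)
    (h : ∀ m : ℕ, m ≤ n → Function.update x k (x k - m) ∈ T) :
    ReflTransGen (adjIn (zdGraph 2) T) x (Function.update x k (x k - n)) := by
  induction n with
  | zero => simp only [Nat.cast_zero, sub_zero, Function.update_eq_self]; exact ReflTransGen.refl
  | succ n ih =>
    refine (ih fun m hm => h m (by omega)).tail ⟨?_, h n (by omega), by exact_mod_cast h (n + 1) le_rfl⟩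
    rw [zdGraph_adj_iff]
    refine ⟨k, Or.inr ?_⟩
    funext j
    by_cases hj : j = k
    · subst hj; simp only [Function.update_self, Pi.add_apply, Pi.single_eq_same]; push_cast; ring
    · simp only [Pi.add_apply, Function.update_of_ne hj, Pi.single_eq_of_ne hj, add_zero]

/-- Moving coordinate `k` from `x k` to `t` along a segment contained in `T`. [folklore] -/
theorem reflTransGen_adjIn_update {T : Set (Site 2)} (x : Site 2) (k : Fin 2) (t : ℤ)
    (h : ∀ w : ℤ, min (x k) t ≤ w → w ≤ max (x k) t → Function.update x k w ∈ T) :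
    ReflTransGen (adjIn (zdGraph 2) T) x (Function.update x k t) := by
  rcases le_or_gt (x k) t with hle | hlt
  · obtain ⟨m, hm⟩ := Int.le.dest hle
    rw [← hm]
    exact reflTransGen_adjIn_update_add x k m fun m' hm' => h _ (by omega) (by omega)
  · obtain ⟨m, hm⟩ := Int.le.dest hlt.le
    rw [show t = x k - m by omega]
    exact reflTransGen_adjIn_update_sub x k m fun m' hm' => h _ (by omega) (by omega)

/-- **A coordinate box of `ℤ²` is nearest-neighbour connected**: any two points of `[a, b]` are joined by a chain of
lattice steps inside the box (first horizontally, then vertically). [folklore] -/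
theorem reflTransGen_adjIn_Icc {a b x y : Site 2} (hx : x ∈ Finset.Icc a b) (hy : y ∈ Finset.Icc a b) :
    ReflTransGen (adjIn (zdGraph 2) (↑(Finset.Icc a b) : Set (Site 2))) x y := by
  rw [mem_Icc_site_iff] at hx hy
  set z : Site 2 := Function.update x 0 (y 0) with hz
  have hz0 : z 0 = y 0 := by simp [hz]
  have hz1 : z 1 = x 1 := by simp [hz]
  have h1 : ReflTransGen (adjIn (zdGraph 2) (↑(Finset.Icc a b) : Set (Site 2))) x z := by
    refine reflTransGen_adjIn_update x 0 (y 0) fun w hw1 hw2 => ?_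
    rw [Finset.mem_coe, mem_Icc_site_iff]
    simp only [Function.update_self, ne_eq, one_ne_zero, not_false_eq_true, Function.update_of_ne]
    omega
  have h2 : ReflTransGen (adjIn (zdGraph 2) (↑(Finset.Icc a b) : Set (Site 2))) z (Function.update z 1 (y 1)) := by
    refine reflTransGen_adjIn_update z 1 (y 1) fun w hw1 hw2 => ?_
    rw [Finset.mem_coe, mem_Icc_site_iff]
    simp only [Function.update_self, ne_eq, zero_ne_one, not_false_eq_true, Function.update_of_ne, hz0]
    omega
  have hzy : Function.update z 1 (y 1) = y := by
    rw [Site.eq_iff_two]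
    simp only [Function.update_self, ne_eq, zero_ne_one, not_false_eq_true, Function.update_of_ne, hz0, and_self]
  rw [hzy] at h2
  exact h1.trans h2

end SlabBox

end Summit.CriticalPhenomena.PercolationContinuityZ3.Theorems.FK

end
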